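/-
COR-CM (cell pub-hodgecm2, stage 2 of the Hodge ladder) — count-neutral KERNEL COMBINATORICS «the dicyclic datum from an index-two subgroup»
(seat prover-pub-hodgecm2-b23-g43-0, binder prover b23, gen 43; claim DICYCLIC-EVEN, HOME/INBOX.md l.10881; blanket `CorCM/FaceDicyclicTwist*`).
Pure group theory, theorems only: gen 42's `DicyclicTwist.Datum` / `DicyclicTwist.exhaust_of_card` (`Census/DicyclicTwistDictionary.lean`,
`Census/DicyclicTwistPlaces.lean`) and gen 39's character lemma `FaceAbelian.exists_addChar_of_not_isSquare` (`CorCM/FaceAbelianDatum.lean`) are used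
BY NAME; no field, no geometry, no named fact, nothing asserted; `Interfaces.lean` (C1), every E term, B01, `Transposition/*`, `PortJoin/*` untouched.
HONEST FRAMING: `HC_CM` is NOT proved, here or anywhere in the tree; nothing here is a period, a count of record or a headline.
T5: n/a-class (hypothesis binders: an index-two subgroup `H ∋ c`, `g² = c` off `H`, `h² ≠ c` on `H`); checker: self, 2026-08-23.
-/
import Summits.HodgeConjecture.CorCM.Census.DicyclicTwistPlaces
import Summits.HodgeConjecture.CorCM.FaceAbelianDatum
import HarnessLib

/-!
# The dicyclic datum from an index-two subgroup: `H ∋ c` of index `2`, `g² = c` off `H`, `c ∉ H²`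

The dicyclic law (`Census/DicyclicTwistLaw.lean`, `CorCM/FaceDicyclicTwistGenerationEven.lean`) is stated along a DICYCLIC DATUM
(`DicyclicTwist.Datum G c A`: an embedded `ι : ℤ/2 × A ↪ G` with `ι(1,0) = c` and a twisting `x` with `x ι(a) x⁻¹ = ι(−a)`, `x² = c`, the two
cosets exhausting `G`).  This file supplies the datum from PURELY GROUP-THEORETIC hypotheses that a field seat can read off a presentation of
`Gal(F/ℚ)`:

**`exists_datum_of_index_two`.**  Let `G` be a finite group, `c ∈ G`, and `H ≤ G` a subgroup of index `2` with `c ∈ H` such that **every element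
outside `H` squares to `c`** and **no element of `H` squares to `c`**.  Then `H` is abelian (conjugation by an outer element inverts `H`:
`conj_eq_inv_of_sq_eq`, `mul_comm_of_sq_eq`), `c² = 1` (`mul_self_eq_one_of_sq_eq`), `c` is a non-square of the abelian group `H`, so gen 39's
character `χ : H → ℤ/2` with `χ(c) = 1` exists and `A = ker χ` is a complement of `⟨c⟩` in `H`; `ι(e, a) = cᵉ·a` and any `x ∉ H` form a dicyclic
datum over `A` (`|G| = 4|A|`).  Conversely every `Dic(ℤ/2 × A, c)` satisfies the hypotheses with `H = ι(ℤ/2 × A)`, so this characterises dicyclic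
type.  Examples: `ℤ/4 ⋊ ℤ/4 = ⟨a, y ∣ a⁴ = y⁴ = 1, y a y⁻¹ = a⁻¹⟩` with `c = y²`, `H = ⟨a, y²⟩`; `ℤ/4 × (ℤ/2)²` with `c = (2,0,0)`,
`H = 2ℤ/4 × (ℤ/2)²`; `Dic_m = ⟨a, x ∣ a^{2m} = 1, x² = a^m, x a x⁻¹ = a⁻¹⟩` with `m` odd, `H = ⟨a⟩`; `Dic₃ × ℤ/2` with `c` in the `Dic₃` factor.
All [folklore].

## References
* [Shimura1998] G. Shimura, Abelian varieties with complex multiplication and modular functions, Princeton 1998, §8.1 (p. 62).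
-/

namespace Summit.HodgeConjecture.CorCM.FaceDicyclicTwist

open Summit.HodgeConjecture.CorCM.Census

section GroupTheory

variable {G : Type} [Group G] {c : G}

/-- If every element outside the subgroup `H` squares to `c`, conjugation by an outer element inverts `H`. [folklore] -/
theorem conj_eq_inv_of_sq_eq (H : Subgroup G) (hsq : ∀ g, g ∉ H → g * g = c) {x : G} (hx : x ∉ H) {h : G} (hh : h ∈ H) :
    x * h * x⁻¹ = h⁻¹ := by
  have hxh : x * h ∉ H := fun hmem => hx ((H.mul_mem_cancel_right hh).mp hmem)
  have h1 : x * h * (x * h) = x * x := by rw [hsq _ hxh, hsq _ hx]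
  have h2 : h * (x * h) = x := mul_left_cancel (by simpa only [mul_assoc] using h1)
  calc x * h * x⁻¹ = h⁻¹ * (h * (x * h)) * x⁻¹ := by group
    _ = h⁻¹ := by rw [h2, mul_assoc, mul_inv_cancel, mul_one]

/-- If `c ∈ H`, `H ≠ G` and every element outside `H` squares to `c`, then `c² = 1`. [folklore] -/
theorem mul_self_eq_one_of_sq_eq (H : Subgroup G) (hc : c ∈ H) (hsq : ∀ g, g ∉ H → g * g = c) {x : G} (hx : x ∉ H) : c * c = 1 := by
  have hxc : x * c ∉ H := fun hmem => hx ((H.mul_mem_cancel_right hc).mp hmem)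
  have hxx : x * x = c := hsq x hx
  have h1 : x * c * (x * c) = c := hsq _ hxc
  have hcomm : x * c = c * x := by rw [← hxx, mul_assoc]
  have h2 : c * (c * c) = c * 1 := by
    calc c * (c * c) = x * x * (c * c) := by rw [hxx]
      _ = x * (x * c) * c := by group
      _ = x * (c * x) * c := by rw [hcomm]
      _ = x * c * (x * c) := by group
      _ = c := h1
      _ = c * 1 := (mul_one c).symm
  exact mul_left_cancel h2

/-- If `H ≠ G` and every element outside `H` squares to the same `c`, then `H` is commutative. [folklore] -/
theorem mul_comm_of_sq_eq (H : Subgroup G) (hsq : ∀ g, g ∉ H → g * g = c) {x : G} (hx : x ∉ H) {a b : G} (ha : a ∈ H) (hb : b ∈ H) :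
    a * b = b * a := by
  have ha' := conj_eq_inv_of_sq_eq H hsq hx ha
  have hb' := conj_eq_inv_of_sq_eq H hsq hx hb
  have hab := conj_eq_inv_of_sq_eq H hsq hx (H.mul_mem ha hb)
  have h1 : x * (a * b) * x⁻¹ = x * a * x⁻¹ * (x * b * x⁻¹) := by group
  rw [hab, ha', hb', mul_inv_rev] at h1
  have h2 := congrArg (·⁻¹) h1
  simpa only [mul_inv_rev, inv_inv] using h2

/-- **The dicyclic datum from an index-two subgroup.**  `H ≤ G` of index `2`, `c ∈ H`, every `g ∉ H` with `g² = c` and no `h ∈ H` with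
`h² = c`: then `G` carries a dicyclic datum over some finite abelian `A` (namely a complement of `⟨c⟩` in the abelian group `H`, cut out by
gen 39's character `χ : H → ℤ/2` with `χ(c) = 1`; `ι(e, a) = cᵉ a`, `x` any outer element). [folklore] -/
theorem exists_datum_of_index_two [Finite G] (H : Subgroup G) (hH : H.index = 2) (hc : c ∈ H) (hsq : ∀ g, g ∉ H → g * g = c)
    (hns : ∀ h ∈ H, h * h ≠ c) :
    ∃ (A : Type) (_ : AddCommGroup A) (_ : Fintype A) (_ : DecidableEq A), Nonempty (DicyclicTwist.Datum G c A) := by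
  classical
  have two_cases : ∀ e : ZMod 2, e = 0 ∨ e = 1 := by decide
  have h11 : (1 : ZMod 2) + 1 = 0 := by decide
  obtain ⟨x, hx⟩ : ∃ x, x ∉ H := by
    by_contra h
    push Not at h
    rw [(Subgroup.eq_top_iff' H).mpr h, Subgroup.index_top] at hH
    exact absurd hH (by norm_num)
  have hcomm : ∀ {a b : G}, a ∈ H → b ∈ H → a * b = b * a := fun ha hb => mul_comm_of_sq_eq H hsq hx ha hb
  have hc2 : c * c = 1 := mul_self_eq_one_of_sq_eq H hc hsq hx
  have hxx : x * x = c := hsq x hx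
  have hxc : x * c = c * x := by rw [← hxx, mul_assoc]
  letI : CommGroup H := { (inferInstance : Group H) with mul_comm := fun a b => Subtype.ext (hcomm a.2 b.2) }
  have hns' : ¬ IsSquare (⟨c, hc⟩ : H) := by
    rintro ⟨r, hr⟩
    exact hns r r.2 (congrArg Subtype.val hr).symm
  obtain ⟨χ, hχ⟩ := FaceAbelian.exists_addChar_of_not_isSquare hns'
  haveI : Fintype G := Fintype.ofFinite G
  -- the complement `A = ker χ` and its embedding into `G`
  let emb : χ.ker → G := fun a => ((Additive.toMul (a : Additive H) : H) : G)
  have emb_mem : ∀ a, emb a ∈ H := fun a => (Additive.toMul (a : Additive H)).2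
  have emb_add : ∀ a b, emb (a + b) = emb a * emb b := fun a b => by
    simp only [emb, AddSubgroup.coe_add, toMul_add, Subgroup.coe_mul]
  have emb_neg : ∀ a, emb (-a) = (emb a)⁻¹ := fun a => by
    simp only [emb, AddSubgroup.coe_neg, toMul_neg, Subgroup.coe_inv]
  have emb_zero : emb 0 = 1 := by simp only [emb, AddSubgroup.coe_zero, toMul_zero, Subgroup.coe_one]
  have emb_inj : Function.Injective emb := fun a b h => Subtype.ext (Additive.toMul.injective (Subtype.ext h))
  have emb_ne : ∀ a, emb a ≠ c := fun a h => by
    have h1 : Additive.toMul (a : Additive H) = ⟨c, hc⟩ := Subtype.ext h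
    have h2 : χ (a : Additive H) = 0 := (AddMonoidHom.mem_ker).mp a.2
    have h3 : (a : Additive H) = Additive.ofMul ⟨c, hc⟩ := by rw [← h1, ofMul_toMul]
    rw [h3, hχ] at h2
    exact one_ne_zero h2
  -- the `⟨c⟩`-part
  let cp : ZMod 2 → G := fun e => if e = 0 then 1 else c
  have cp_add : ∀ e e', cp (e + e') = cp e * cp e' := by
    intro e e'
    rcases two_cases e with rfl | rfl <;> rcases two_cases e' with rfl | rfl <;> simp [cp, h11, hc2]
  have cp_mem : ∀ e, cp e ∈ H := fun e => by
    rcases two_cases e with rfl | rfl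
    · simp only [cp, if_pos]; exact H.one_mem
    · simp only [cp, if_neg one_ne_zero]; exact hc
  have cp_comm_x : ∀ e, x * cp e = cp e * x := fun e => by
    rcases two_cases e with rfl | rfl
    · simp only [cp, if_pos, mul_one, one_mul]
    · simp only [cp, if_neg one_ne_zero, hxc]
  have cp_neg : ∀ e : ZMod 2, cp (-e) = cp e := fun e => by rw [ZMod.neg_eq_self_mod_two]
  -- the embedding `ι (e, a) = cᵉ · a`
  let ι : ZMod 2 × χ.ker → G := fun p => cp p.1 * emb p.2
  have ι_mem : ∀ p, ι p ∈ H := fun p => H.mul_mem (cp_mem p.1) (emb_mem p.2)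
  have map_add : ∀ p q, ι (p + q) = ι p * ι q := fun p q => by
    show cp (p.1 + q.1) * emb (p.2 + q.2) = cp p.1 * emb p.2 * (cp q.1 * emb q.2)
    rw [cp_add, emb_add]
    have h := hcomm (emb_mem p.2) (cp_mem q.1)
    simp only [mul_assoc]
    congr 1
    rw [← mul_assoc, ← mul_assoc, h]
  have map_c : ι (1, 0) = c := by
    show cp 1 * emb 0 = c
    rw [emb_zero, mul_one]
    simp only [cp, if_neg one_ne_zero]
  have x_mul : ∀ p, x * ι p = ι (-p) * x := fun p => by
    show x * (cp p.1 * emb p.2) = cp (-p.1) * emb (-p.2) * x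
    rw [cp_neg, emb_neg]
    have h := conj_eq_inv_of_sq_eq H hsq hx (emb_mem p.2)
    calc x * (cp p.1 * emb p.2) = cp p.1 * (x * emb p.2 * x⁻¹) * x := by rw [← mul_assoc, cp_comm_x]; group
      _ = cp p.1 * (emb p.2)⁻¹ * x := by rw [h]
  have x_ne : ∀ p, x ≠ ι p := fun p h => hx (h ▸ ι_mem p)
  have inj : Function.Injective ι := by
    rintro ⟨e, a⟩ ⟨e', b⟩ h
    change cp e * emb a = cp e' * emb b at h
    have key : e = e' := by
      by_contra hne
      rcases two_cases e with rfl | rfl <;> rcases two_cases e' with rfl | rfl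
      · exact hne rfl
      · simp only [cp, if_pos, if_neg one_ne_zero, one_mul] at h
        apply emb_ne (a - b)
        rw [sub_eq_add_neg, emb_add, emb_neg, h, mul_assoc, mul_inv_cancel, mul_one]
      · simp only [cp, if_pos, if_neg one_ne_zero, one_mul] at h
        apply emb_ne (b - a)
        rw [sub_eq_add_neg, emb_add, emb_neg, ← h, mul_assoc, mul_inv_cancel, mul_one]
      · exact hne rfl
    subst key
    exact Prod.ext rfl (emb_inj (mul_left_cancel h))
  -- counting: `|G| = 2|H| = 4|A|`
  have hcard : Fintype.card G = 4 * Fintype.card χ.ker := by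
    have h1 : H.index * Nat.card H = Nat.card G := Subgroup.index_mul_card (H := H)
    have hrange : χ.range = ⊤ := by
      rw [AddMonoidHom.range_eq_top]
      intro z
      rcases two_cases z with rfl | rfl
      · exact ⟨0, map_zero χ⟩
      · exact ⟨Additive.ofMul ⟨c, hc⟩, hχ⟩
    have h2 : χ.ker.index = 2 := by
      rw [AddSubgroup.index_ker, hrange, AddSubgroup.card_top, Nat.card_zmod]
    have h3 : χ.ker.index * Nat.card χ.ker = Nat.card (Additive H) := AddSubgroup.index_mul_card (H := χ.ker)
    have h4 : Nat.card (Additive H) = Nat.card H := rfl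
    rw [← Nat.card_eq_fintype_card, ← Nat.card_eq_fintype_card, ← h1, hH, ← h4, ← h3, h2]
    ring
  exact ⟨χ.ker, inferInstance, inferInstance, inferInstance,
    ⟨{ ι := ι, x := x, map_add := map_add, map_c := map_c, x_mul := x_mul, x_mul_x := hxx, inj := inj, x_ne := x_ne,
       exhaust := DicyclicTwist.exhaust_of_card ι x map_add inj x_ne hcard }⟩⟩

end GroupTheory

end Summit.HodgeConjecture.CorCM.FaceDicyclicTwist
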